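import Summits.RiemannHypothesis.RiemannHypothesis.Theorems.WeilFormatCSectorSplit
import HarnessLib

/-!
# Format C: transferring quadratic-form bounds from `ℤ`-modes to the two SECTOR KERNELS on far truncations

Route context: Fourier–Galerkin / Schur-complement certificates of Weil positivity on a window ("format C";
cell memo `run/shared/lean/pub/rh-explicit/rh-explicit-weil-10/FORMATC-DESIGN.md` §4.3 / §9; supporting
stmt-RiemannHypothesis-0098; seat rh-explicit-weil-10).  The far-coercivity lemma L-C3a is consumed by
`WeilFormatC.sum_range_mul_mul_nonneg_of_certificate` (`WeilFormatCSoundness.lean`) as a bound on the SECTOR kernels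
`M⁺_G(n,m) = [n=0: G(0,m) | m=0: G(n,0) | (G(n,m)+G(n,−m))/2]`, `M⁻_G(k,l) = (G(k+1,l+1) − G(k+1,−(l+1)))/2` of
weil-2's `WeilFormatCSectorSplit.lean` on the far truncations `Ico B N`; the analytic pieces (PRIME
`WeilFormatCPrimeFormBound.lean`, POLAR, the archimedean Hilbert/HS parts) are naturally proved for the `ℤ`-indexed
kernel `G` on vectors `x : ℤ → ℝ` of a given parity supported on far modes.  THIS FILE is the dictionary between the
two, via the explicit lifts (written inline, no definitions)

  even: `x_p = y_{|p|}/2` for `B ≤ |p| < N`, else `0`;   odd: `x_p = sign(p)·z_{|p|−1}/2` for `B+1 ≤ |p| ≤ N`, else `0`: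

* `even_lift_form_eq` / `odd_lift_form_eq` — `Σ_{p,q ∈ modes N} x_p x_q G(p,q) = Σ_{n,m ∈ Ico B N} y_n M⁺(n,m) y_m`
  (resp. `= Σ_{k,l ∈ Ico B N} z_k M⁻(k,l) z_l`);
* `even_lift_weight_eq` / `odd_lift_weight_eq` — `Σ_{p ∈ modes N} e(|p|) x_p² = ½ Σ_{n ∈ Ico B N} e(n) y_n²`
  (resp. `= ½ Σ_{k ∈ Ico B N} e(k+1) z_k²`);
* the transfers `even_far_lower_of_modes`, `even_far_abs_of_modes`, `odd_far_lower_of_modes`, `odd_far_abs_of_modes`: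
  a bound `Σ e(|p|) x_p² ≤ xᵀGx` (resp. `|xᵀGx| ≤ Σ e(|p|) x_p²`) for all even (odd) real `x` supported on the far
  modes gives `Σ (e_n/2) y_n² ≤ yᵀM⁺y` (resp. `|yᵀM⁺y| ≤ Σ (e_n/2) y_n²`) on `Ico B N`, and the odd analogues with
  weight `e(k+1)/2` — exactly the hypothesis shapes `hDdiag/hP/hQ/hH/hE` of `WeilFormatC.farBlock_ge_dhat` and `hfar` of
  the soundness theorem.  NORMALISATION: the factor `½` is `M⁺ = W⁺/2`, `M⁻ = W⁻/2` (off mode 0) relative to the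
  orthonormal sector bases `(χ_n ± χ_{−n})/√2` of Yoshida (6.10).

Pure `Finset` algebra; standard axioms; no RH claim.
-/

set_option autoImplicit false
-- `Summit.RiemannHypothesis.RiemannHypothesis.…` is the layout-mandated namespace (summit = problem name).
set_option linter.dupNamespace false

noncomputable section

open Finset
open scoped BigOperators

namespace Summit.RiemannHypothesis.RiemannHypothesis.Theorems.WeilFormatC

open Literature.NumberTheory.LFunctions.Yoshida1992 (modes)

variable (G : ℤ → ℤ → ℝ)

/-! ## Reindexing helpers -/

/-- `Σ_{k<N} g(k+1) = Σ_{n ∈ Ico B N} g(n)` when `g` vanishes off `Ico B N` and `1 ≤ B`. -/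
theorem sum_range_succ_eq_sum_Ico {B N : ℕ} (hB : 1 ≤ B) (g : ℕ → ℝ)
    (hg : ∀ n, ¬ (B ≤ n ∧ n < N) → g n = 0) :
    ∑ k ∈ Finset.range N, g (k + 1) = ∑ n ∈ Ico B N, g n := by
  rw [Finset.range_eq_Ico, Finset.sum_Ico_add' g 0 N 1, zero_add]
  symm
  refine Finset.sum_subset (Finset.Ico_subset_Ico hB (Nat.le_succ N)) fun n _ hn ↦ hg n ?_
  rwa [Finset.mem_Ico] at hn

/-- `Σ_{k<N} g(k) = Σ_{k ∈ Ico B N} g(k)` when `g` vanishes off `Ico B N`. -/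
theorem sum_range_eq_sum_Ico {B N : ℕ} (g : ℕ → ℝ) (hg : ∀ k, ¬ (B ≤ k ∧ k < N) → g k = 0) :
    ∑ k ∈ Finset.range N, g k = ∑ k ∈ Ico B N, g k := by
  symm
  refine Finset.sum_subset (fun k hk ↦ Finset.mem_range.2 (Finset.mem_Ico.1 hk).2) fun k _ hk ↦ hg k ?_
  rwa [Finset.mem_Ico] at hk

/-- `Σ_{n ≤ N} g(n) = Σ_{n ∈ Ico B N} g(n)` when `g` vanishes off `Ico B N`. -/
theorem sum_range_succ_eq_sum_Ico' {B N : ℕ} (g : ℕ → ℝ) (hg : ∀ n, ¬ (B ≤ n ∧ n < N) → g n = 0) :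
    ∑ n ∈ Finset.range (N + 1), g n = ∑ n ∈ Ico B N, g n := by
  symm
  refine Finset.sum_subset (fun n hn ↦ Finset.mem_range.2 ?_) fun n _ hn ↦ hg n ?_
  · exact Nat.lt_succ_of_lt (Finset.mem_Ico.1 hn).2
  · rwa [Finset.mem_Ico] at hn

/-! ## The even lift -/

section Even

variable {B N : ℕ}

/-- The even lift is even. -/
theorem even_lift_neg (y : ℕ → ℝ) (p : ℤ) :
    (fun q : ℤ ↦ if B ≤ q.natAbs ∧ q.natAbs < N then y q.natAbs / 2 else 0) (-p)
      = (fun q : ℤ ↦ if B ≤ q.natAbs ∧ q.natAbs < N then y q.natAbs / 2 else 0) p := by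
  simp only [Int.natAbs_neg]

/-- The even lift vanishes off the far modes `B ≤ |p| < N`. -/
theorem even_lift_eq_zero (y : ℕ → ℝ) (p : ℤ) (hp : p.natAbs < B ∨ N ≤ p.natAbs) :
    (fun q : ℤ ↦ if B ≤ q.natAbs ∧ q.natAbs < N then y q.natAbs / 2 else 0) p = 0 := by
  simp only
  rw [if_neg]
  omega

/-- Folding the even lift: `x_n + x_{−n}` (and `x_0` at `n = 0`) is `y_n·1_{Ico B N}(n)` (`1 ≤ B`). -/
theorem even_lift_fold (hB : 1 ≤ B) (y : ℕ → ℝ) (n : ℕ) :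
    (if n = 0 then (fun q : ℤ ↦ if B ≤ q.natAbs ∧ q.natAbs < N then y q.natAbs / 2 else 0) 0
      else (fun q : ℤ ↦ if B ≤ q.natAbs ∧ q.natAbs < N then y q.natAbs / 2 else 0) n
        + (fun q : ℤ ↦ if B ≤ q.natAbs ∧ q.natAbs < N then y q.natAbs / 2 else 0) (-(n : ℤ)))
      = if B ≤ n ∧ n < N then y n else 0 := by
  by_cases hn : n = 0
  · subst hn
    simp only [if_true, Int.natAbs_zero]
    rw [if_neg (by omega), if_neg (by omega)]
  · simp only [if_neg hn, Int.natAbs_neg, Int.natAbs_natCast]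
    split_ifs <;> ring

/-- **Even lift, quadratic form.**  For `G` reflection-symmetric and `1 ≤ B`:
`Σ_{p,q ∈ modes N} x_p x_q G(p,q) = Σ_{n,m ∈ Ico B N} y_n M⁺_G(n,m) y_m`. -/
theorem even_lift_form_eq (hrefl : ∀ n m, G (-n) (-m) = G n m) (hB : 1 ≤ B) (y : ℕ → ℝ) :
    ∑ p ∈ modes N, ∑ q ∈ modes N,
      (fun q : ℤ ↦ if B ≤ q.natAbs ∧ q.natAbs < N then y q.natAbs / 2 else 0) p *
        (fun q : ℤ ↦ if B ≤ q.natAbs ∧ q.natAbs < N then y q.natAbs / 2 else 0) q * G p q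
      = ∑ n ∈ Ico B N, ∑ m ∈ Ico B N,
          y n * (if n = 0 then G 0 m else if m = 0 then G n 0 else (G n m + G n (-(m : ℤ))) / 2) * y m := by
  rw [sum_modes_mul_mul_eq_sectors G hrefl N]
  -- the odd part vanishes
  have hz : ∀ k : ℕ, (fun q : ℤ ↦ if B ≤ q.natAbs ∧ q.natAbs < N then y q.natAbs / 2 else 0) ((k : ℤ) + 1)
      - (fun q : ℤ ↦ if B ≤ q.natAbs ∧ q.natAbs < N then y q.natAbs / 2 else 0) (-((k : ℤ) + 1)) = 0 := by
    intro k; rw [even_lift_neg, sub_self]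
  simp_rw [hz, zero_mul, Finset.sum_const_zero, add_zero]
  -- the even part: fold and restrict to `Ico B N`
  simp_rw [even_lift_fold hB y]
  rw [sum_range_succ_eq_sum_Ico' _ (fun n hn ↦ by
    rw [if_neg hn]; simp only [zero_mul, Finset.sum_const_zero])]
  refine Finset.sum_congr rfl fun n hn ↦ ?_
  rw [Finset.mem_Ico] at hn
  rw [if_pos hn, sum_range_succ_eq_sum_Ico' _ (fun m hm ↦ by rw [if_neg hm]; ring)]
  refine Finset.sum_congr rfl fun m hm ↦ ?_
  rw [Finset.mem_Ico] at hm
  rw [if_pos hm]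
  ring

/-- **Even lift, weighted squares.**  For `1 ≤ B`: `Σ_{p ∈ modes N} e(|p|) x_p² = ½ Σ_{n ∈ Ico B N} e(n) y_n²`. -/
theorem even_lift_weight_eq (hB : 1 ≤ B) (e y : ℕ → ℝ) :
    ∑ p ∈ modes N, e p.natAbs *
        (fun q : ℤ ↦ if B ≤ q.natAbs ∧ q.natAbs < N then y q.natAbs / 2 else 0) p ^ 2
      = (1 / 2) * ∑ n ∈ Ico B N, e n * y n ^ 2 := by
  rw [sum_modes_eq]
  simp only [Int.natAbs_zero, Int.natAbs_neg]
  rw [if_neg (by omega)]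
  have hk : ∀ k : ℕ, ((k : ℤ) + 1).natAbs = k + 1 := fun k ↦ by
    rw [show ((k : ℤ) + 1) = ((k + 1 : ℕ) : ℤ) by push_cast; ring, Int.natAbs_natCast]
  simp_rw [hk]
  rw [Finset.mul_sum, sum_range_succ_eq_sum_Ico hB (fun n ↦ e n * (if B ≤ n ∧ n < N then y n / 2 else 0) ^ 2
    + e n * (if B ≤ n ∧ n < N then y n / 2 else 0) ^ 2) (fun n hn ↦ by rw [if_neg hn]; ring)]
  simp only [zero_pow two_ne_zero, mul_zero, zero_add]
  refine Finset.sum_congr rfl fun n hn ↦ ?_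
  rw [Finset.mem_Ico] at hn
  rw [if_pos hn]
  ring

/-- **Transfer of a lower bound to the even sector kernel.**  If `Σ_p e(|p|) x_p² ≤ xᵀGx` for every EVEN real `x`
on `modes N` supported on `B ≤ |p| < N` (`1 ≤ B`, `G` reflection-symmetric), then
`Σ_{n∈Ico B N} (e_n/2) y_n² ≤ Σ_{n,m∈Ico B N} y_n M⁺_G(n,m) y_m` for every `y`. -/
theorem even_far_lower_of_modes (hrefl : ∀ n m, G (-n) (-m) = G n m) (hB : 1 ≤ B) (e : ℕ → ℝ)
    (h : ∀ x : ℤ → ℝ, (∀ p, x (-p) = x p) → (∀ p : ℤ, p.natAbs < B ∨ N ≤ p.natAbs → x p = 0) →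
      ∑ p ∈ modes N, e p.natAbs * x p ^ 2 ≤ ∑ p ∈ modes N, ∑ q ∈ modes N, x p * x q * G p q)
    (y : ℕ → ℝ) :
    ∑ n ∈ Ico B N, e n / 2 * y n ^ 2 ≤ ∑ n ∈ Ico B N, ∑ m ∈ Ico B N,
      y n * (if n = 0 then G 0 m else if m = 0 then G n 0 else (G n m + G n (-(m : ℤ))) / 2) * y m := by
  have key := h (fun q : ℤ ↦ if B ≤ q.natAbs ∧ q.natAbs < N then y q.natAbs / 2 else 0)
    (even_lift_neg y) (even_lift_eq_zero y)
  rw [even_lift_form_eq G hrefl hB y, even_lift_weight_eq hB e y, Finset.mul_sum] at key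
  refine le_trans (le_of_eq (Finset.sum_congr rfl fun n _ ↦ by ring)) key

/-- **Transfer of an absolute bound to the even sector kernel.**  If `|xᵀGx| ≤ Σ_p e(|p|) x_p²` for every EVEN real
`x` supported on `B ≤ |p| < N`, then `|Σ_{n,m∈Ico B N} y_n M⁺_G(n,m) y_m| ≤ Σ_{n∈Ico B N} (e_n/2) y_n²`. -/
theorem even_far_abs_of_modes (hrefl : ∀ n m, G (-n) (-m) = G n m) (hB : 1 ≤ B) (e : ℕ → ℝ)
    (h : ∀ x : ℤ → ℝ, (∀ p, x (-p) = x p) → (∀ p : ℤ, p.natAbs < B ∨ N ≤ p.natAbs → x p = 0) →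
      |∑ p ∈ modes N, ∑ q ∈ modes N, x p * x q * G p q| ≤ ∑ p ∈ modes N, e p.natAbs * x p ^ 2)
    (y : ℕ → ℝ) :
    |∑ n ∈ Ico B N, ∑ m ∈ Ico B N,
      y n * (if n = 0 then G 0 m else if m = 0 then G n 0 else (G n m + G n (-(m : ℤ))) / 2) * y m|
      ≤ ∑ n ∈ Ico B N, e n / 2 * y n ^ 2 := by
  have key := h (fun q : ℤ ↦ if B ≤ q.natAbs ∧ q.natAbs < N then y q.natAbs / 2 else 0)
    (even_lift_neg y) (even_lift_eq_zero y)
  rw [even_lift_form_eq G hrefl hB y, even_lift_weight_eq hB e y, Finset.mul_sum] at key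
  exact key.trans (le_of_eq (Finset.sum_congr rfl fun n _ ↦ by ring))

/-- Constant-weight form of `even_far_lower_of_modes`: `c·Σ x_p² ≤ xᵀGx` on even far vectors gives
`(c/2)·Σ y_n² ≤ yᵀM⁺y`; with `c = −2A` this is hypothesis `hP`/`hQ` of `WeilFormatC.farBlock_ge_dhat`. -/
theorem even_far_lower_const_of_modes (hrefl : ∀ n m, G (-n) (-m) = G n m) (hB : 1 ≤ B) (c : ℝ)
    (h : ∀ x : ℤ → ℝ, (∀ p, x (-p) = x p) → (∀ p : ℤ, p.natAbs < B ∨ N ≤ p.natAbs → x p = 0) →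
      c * ∑ p ∈ modes N, x p ^ 2 ≤ ∑ p ∈ modes N, ∑ q ∈ modes N, x p * x q * G p q)
    (y : ℕ → ℝ) :
    c / 2 * ∑ n ∈ Ico B N, y n ^ 2 ≤ ∑ n ∈ Ico B N, ∑ m ∈ Ico B N,
      y n * (if n = 0 then G 0 m else if m = 0 then G n 0 else (G n m + G n (-(m : ℤ))) / 2) * y m := by
  have h' := even_far_lower_of_modes G hrefl hB (fun _ ↦ c) (fun x hx hs ↦ by
    rw [← Finset.mul_sum]; exact h x hx hs) y
  rw [Finset.mul_sum]
  simpa using h'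

end Even

/-! ## The odd lift -/

section Odd

variable {B N : ℕ}

/-- The odd lift is odd. -/
theorem odd_lift_neg (z : ℕ → ℝ) (p : ℤ) :
    (fun q : ℤ ↦ if B + 1 ≤ q.natAbs ∧ q.natAbs ≤ N then (q.sign : ℝ) * z (q.natAbs - 1) / 2 else 0) (-p)
      = -(fun q : ℤ ↦ if B + 1 ≤ q.natAbs ∧ q.natAbs ≤ N then (q.sign : ℝ) * z (q.natAbs - 1) / 2 else 0) p := by
  simp only [Int.natAbs_neg, Int.sign_neg, Int.cast_neg]
  split_ifs <;> ring

/-- The odd lift vanishes off the far modes `B + 1 ≤ |p| ≤ N`. -/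
theorem odd_lift_eq_zero (z : ℕ → ℝ) (p : ℤ) (hp : p.natAbs < B + 1 ∨ N + 1 ≤ p.natAbs) :
    (fun q : ℤ ↦ if B + 1 ≤ q.natAbs ∧ q.natAbs ≤ N then (q.sign : ℝ) * z (q.natAbs - 1) / 2 else 0) p = 0 := by
  simp only
  rw [if_neg]
  omega

/-- The odd lift at a positive mode `k+1`: `x_{k+1} = z_k/2 · 1_{Ico B N}(k)`. -/
theorem odd_lift_succ (z : ℕ → ℝ) (k : ℕ) :
    (fun q : ℤ ↦ if B + 1 ≤ q.natAbs ∧ q.natAbs ≤ N then (q.sign : ℝ) * z (q.natAbs - 1) / 2 else 0) ((k : ℤ) + 1)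
      = if B ≤ k ∧ k < N then z k / 2 else 0 := by
  have hk : ((k : ℤ) + 1).natAbs = k + 1 := by
    rw [show ((k : ℤ) + 1) = ((k + 1 : ℕ) : ℤ) by push_cast; ring, Int.natAbs_natCast]
  have hs : ((k : ℤ) + 1).sign = 1 := by
    rw [show ((k : ℤ) + 1) = ((k + 1 : ℕ) : ℤ) by push_cast; ring]
    exact Int.sign_natCast_of_ne_zero (Nat.succ_ne_zero k)
  simp only [hk, hs, Int.cast_one, one_mul, Nat.add_sub_cancel]
  by_cases h : B ≤ k ∧ k < N
  · rw [if_pos h, if_pos (by omega)]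
  · rw [if_neg h, if_neg (by omega)]

/-- Folding the odd lift: `x_{k+1} − x_{−(k+1)} = z_k·1_{Ico B N}(k)` and `x_n + x_{−n} = 0`, `x_0 = 0`. -/
theorem odd_lift_fold_sub (z : ℕ → ℝ) (k : ℕ) :
    (fun q : ℤ ↦ if B + 1 ≤ q.natAbs ∧ q.natAbs ≤ N then (q.sign : ℝ) * z (q.natAbs - 1) / 2 else 0) ((k : ℤ) + 1)
      - (fun q : ℤ ↦ if B + 1 ≤ q.natAbs ∧ q.natAbs ≤ N then (q.sign : ℝ) * z (q.natAbs - 1) / 2 else 0)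
          (-((k : ℤ) + 1))
      = if B ≤ k ∧ k < N then z k else 0 := by
  rw [odd_lift_neg, sub_neg_eq_add, odd_lift_succ]
  split_ifs <;> ring

/-- For the odd lift the even folding vanishes. -/
theorem odd_lift_fold_add (z : ℕ → ℝ) (n : ℕ) :
    (if n = 0 then
        (fun q : ℤ ↦ if B + 1 ≤ q.natAbs ∧ q.natAbs ≤ N then (q.sign : ℝ) * z (q.natAbs - 1) / 2 else 0) 0
      else (fun q : ℤ ↦ if B + 1 ≤ q.natAbs ∧ q.natAbs ≤ N then (q.sign : ℝ) * z (q.natAbs - 1) / 2 else 0) n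
        + (fun q : ℤ ↦ if B + 1 ≤ q.natAbs ∧ q.natAbs ≤ N then (q.sign : ℝ) * z (q.natAbs - 1) / 2 else 0)
            (-(n : ℤ))) = 0 := by
  by_cases hn : n = 0
  · subst hn
    simp only [if_true, Int.natAbs_zero]
    rw [if_neg (by omega)]
  · rw [if_neg hn, odd_lift_neg, add_neg_cancel]

/-- **Odd lift, quadratic form.**  For `G` reflection-symmetric:
`Σ_{p,q ∈ modes N} x_p x_q G(p,q) = Σ_{k,l ∈ Ico B N} z_k M⁻_G(k,l) z_l`. -/
theorem odd_lift_form_eq (hrefl : ∀ n m, G (-n) (-m) = G n m) (z : ℕ → ℝ) :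
    ∑ p ∈ modes N, ∑ q ∈ modes N,
      (fun q : ℤ ↦ if B + 1 ≤ q.natAbs ∧ q.natAbs ≤ N then (q.sign : ℝ) * z (q.natAbs - 1) / 2 else 0) p *
        (fun q : ℤ ↦ if B + 1 ≤ q.natAbs ∧ q.natAbs ≤ N then (q.sign : ℝ) * z (q.natAbs - 1) / 2 else 0) q *
          G p q
      = ∑ k ∈ Ico B N, ∑ l ∈ Ico B N,
          z k * ((G ((k : ℤ) + 1) ((l : ℤ) + 1) - G ((k : ℤ) + 1) (-((l : ℤ) + 1))) / 2) * z l := by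
  rw [sum_modes_mul_mul_eq_sectors G hrefl N]
  simp_rw [odd_lift_fold_add z, zero_mul, Finset.sum_const_zero, zero_add, odd_lift_fold_sub z]
  rw [sum_range_eq_sum_Ico _ (fun k hk ↦ by
    rw [if_neg hk]; simp only [zero_mul, Finset.sum_const_zero])]
  refine Finset.sum_congr rfl fun k hk ↦ ?_
  rw [Finset.mem_Ico] at hk
  rw [if_pos hk, sum_range_eq_sum_Ico _ (fun l hl ↦ by rw [if_neg hl]; ring)]
  refine Finset.sum_congr rfl fun l hl ↦ ?_
  rw [Finset.mem_Ico] at hl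
  rw [if_pos hl]
  ring

/-- **Odd lift, weighted squares.**  `Σ_{p ∈ modes N} e(|p|) x_p² = ½ Σ_{k ∈ Ico B N} e(k+1) z_k²`. -/
theorem odd_lift_weight_eq (e z : ℕ → ℝ) :
    ∑ p ∈ modes N, e p.natAbs *
        (fun q : ℤ ↦ if B + 1 ≤ q.natAbs ∧ q.natAbs ≤ N then (q.sign : ℝ) * z (q.natAbs - 1) / 2 else 0) p ^ 2
      = (1 / 2) * ∑ k ∈ Ico B N, e (k + 1) * z k ^ 2 := by
  have hk : ∀ k : ℕ, ((k : ℤ) + 1).natAbs = k + 1 := fun k ↦ by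
    rw [show ((k : ℤ) + 1) = ((k + 1 : ℕ) : ℤ) by push_cast; ring, Int.natAbs_natCast]
  have hs : ∀ k : ℕ, ((k : ℤ) + 1).sign = 1 := fun k ↦ by
    rw [show ((k : ℤ) + 1) = ((k + 1 : ℕ) : ℤ) by push_cast; ring]
    exact Int.sign_natCast_of_ne_zero (Nat.succ_ne_zero k)
  have hterm : ∀ k : ℕ,
      e ((k : ℤ) + 1).natAbs *
          (fun q : ℤ ↦ if B + 1 ≤ q.natAbs ∧ q.natAbs ≤ N then (q.sign : ℝ) * z (q.natAbs - 1) / 2 else 0)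
            ((k : ℤ) + 1) ^ 2
        + e (-((k : ℤ) + 1)).natAbs *
          (fun q : ℤ ↦ if B + 1 ≤ q.natAbs ∧ q.natAbs ≤ N then (q.sign : ℝ) * z (q.natAbs - 1) / 2 else 0)
            (-((k : ℤ) + 1)) ^ 2
        = if B ≤ k ∧ k < N then e (k + 1) * z k ^ 2 / 2 else 0 := by
    intro k
    simp only [Int.natAbs_neg, Int.sign_neg, Int.cast_neg, hk, hs, Int.cast_one, one_mul, Nat.add_sub_cancel]
    split_ifs <;> (try ring) <;> omega
  have h0 : e (0 : ℤ).natAbs *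
      (fun q : ℤ ↦ if B + 1 ≤ q.natAbs ∧ q.natAbs ≤ N then (q.sign : ℝ) * z (q.natAbs - 1) / 2 else 0) 0 ^ 2
        = 0 := by
    simp only [Int.natAbs_zero]
    rw [if_neg (by omega)]
    ring
  rw [sum_modes_eq, Finset.sum_congr rfl fun k _ ↦ hterm k, h0, zero_add, Finset.mul_sum,
    sum_range_eq_sum_Ico (fun k ↦ if B ≤ k ∧ k < N then e (k + 1) * z k ^ 2 / 2 else 0)
      (fun k hk ↦ by rw [if_neg hk])]
  refine Finset.sum_congr rfl fun k hk ↦ ?_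
  rw [Finset.mem_Ico] at hk
  rw [if_pos hk]
  ring

/-- **Transfer of a lower bound to the odd sector kernel.**  If `Σ_p e(|p|) x_p² ≤ xᵀGx` for every ODD real `x` on
`modes N` supported on `B+1 ≤ |p| ≤ N`, then `Σ_{k∈Ico B N} (e(k+1)/2) z_k² ≤ Σ_{k,l∈Ico B N} z_k M⁻_G(k,l) z_l`. -/
theorem odd_far_lower_of_modes (hrefl : ∀ n m, G (-n) (-m) = G n m) (e : ℕ → ℝ)
    (h : ∀ x : ℤ → ℝ, (∀ p, x (-p) = -x p) → (∀ p : ℤ, p.natAbs < B + 1 ∨ N + 1 ≤ p.natAbs → x p = 0) →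
      ∑ p ∈ modes N, e p.natAbs * x p ^ 2 ≤ ∑ p ∈ modes N, ∑ q ∈ modes N, x p * x q * G p q)
    (z : ℕ → ℝ) :
    ∑ k ∈ Ico B N, e (k + 1) / 2 * z k ^ 2 ≤ ∑ k ∈ Ico B N, ∑ l ∈ Ico B N,
      z k * ((G ((k : ℤ) + 1) ((l : ℤ) + 1) - G ((k : ℤ) + 1) (-((l : ℤ) + 1))) / 2) * z l := by
  have key := h
    (fun q : ℤ ↦ if B + 1 ≤ q.natAbs ∧ q.natAbs ≤ N then (q.sign : ℝ) * z (q.natAbs - 1) / 2 else 0)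
    (odd_lift_neg z) (odd_lift_eq_zero z)
  rw [odd_lift_form_eq G hrefl z, odd_lift_weight_eq e z, Finset.mul_sum] at key
  refine le_trans (le_of_eq (Finset.sum_congr rfl fun k _ ↦ by ring)) key

/-- **Transfer of an absolute bound to the odd sector kernel.**  If `|xᵀGx| ≤ Σ_p e(|p|) x_p²` for every ODD real
`x` supported on `B+1 ≤ |p| ≤ N`, then `|Σ_{k,l∈Ico B N} z_k M⁻_G(k,l) z_l| ≤ Σ_{k∈Ico B N} (e(k+1)/2) z_k²`. -/
theorem odd_far_abs_of_modes (hrefl : ∀ n m, G (-n) (-m) = G n m) (e : ℕ → ℝ)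
    (h : ∀ x : ℤ → ℝ, (∀ p, x (-p) = -x p) → (∀ p : ℤ, p.natAbs < B + 1 ∨ N + 1 ≤ p.natAbs → x p = 0) →
      |∑ p ∈ modes N, ∑ q ∈ modes N, x p * x q * G p q| ≤ ∑ p ∈ modes N, e p.natAbs * x p ^ 2)
    (z : ℕ → ℝ) :
    |∑ k ∈ Ico B N, ∑ l ∈ Ico B N,
      z k * ((G ((k : ℤ) + 1) ((l : ℤ) + 1) - G ((k : ℤ) + 1) (-((l : ℤ) + 1))) / 2) * z l|
      ≤ ∑ k ∈ Ico B N, e (k + 1) / 2 * z k ^ 2 := by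
  have key := h
    (fun q : ℤ ↦ if B + 1 ≤ q.natAbs ∧ q.natAbs ≤ N then (q.sign : ℝ) * z (q.natAbs - 1) / 2 else 0)
    (odd_lift_neg z) (odd_lift_eq_zero z)
  rw [odd_lift_form_eq G hrefl z, odd_lift_weight_eq e z, Finset.mul_sum] at key
  exact key.trans (le_of_eq (Finset.sum_congr rfl fun k _ ↦ by ring))

/-- Constant-weight form of `odd_far_lower_of_modes`: `c·Σ x_p² ≤ xᵀGx` on odd far vectors gives
`(c/2)·Σ z_k² ≤ zᵀM⁻z`. -/
theorem odd_far_lower_const_of_modes (hrefl : ∀ n m, G (-n) (-m) = G n m) (c : ℝ)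
    (h : ∀ x : ℤ → ℝ, (∀ p, x (-p) = -x p) → (∀ p : ℤ, p.natAbs < B + 1 ∨ N + 1 ≤ p.natAbs → x p = 0) →
      c * ∑ p ∈ modes N, x p ^ 2 ≤ ∑ p ∈ modes N, ∑ q ∈ modes N, x p * x q * G p q)
    (z : ℕ → ℝ) :
    c / 2 * ∑ k ∈ Ico B N, z k ^ 2 ≤ ∑ k ∈ Ico B N, ∑ l ∈ Ico B N,
      z k * ((G ((k : ℤ) + 1) ((l : ℤ) + 1) - G ((k : ℤ) + 1) (-((l : ℤ) + 1))) / 2) * z l := by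
  have h' := odd_far_lower_of_modes G hrefl (fun _ ↦ c) (fun x hx hs ↦ by
    rw [← Finset.mul_sum]; exact h x hx hs) z
  rw [Finset.mul_sum]
  simpa using h'

end Odd

end Summit.RiemannHypothesis.RiemannHypothesis.Theorems.WeilFormatC

end
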